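import Mathlib.Data.Real.Basic
import Mathlib.Data.Fin.Tuple.Basic
import Mathlib.Algebra.BigOperators.Fin
import Mathlib.Tactic.Ring
import Mathlib.Tactic.Linarith
import Mathlib.Tactic.Positivity
import HarnessLib

/-!
# `NoHeavyLowerTail` (crux stmt-CriticalPhenomena-4575), master-family line P2 (Sahi's algebraic route):
# the ROW POLYNOMIAL of the sunflower tower in recursive form — `J_n(a; c)` — and its algebra

Support file (seat `prim-masterthm-p2`, gen 4; `--supports stmt-CriticalPhenomena-4575`); pure algebra, no sorry, no named fact.
Memo: run/shared/lean/prim/prim-masterthm/prim-masterthm-p2/SAHI-ROUTE.md §4.10(a) (closed form of the sunflower row), §4.13 (this gen).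

For an `n`-sunflower of events with core mass `a`, petal masses `c_0, …, c_{n−1}` and outside mass `b = 1 − a − Σ c`, Sahi's functional of
the complements `D_i` of the members is (memo §4.10(a), proved on paper by Sahi's generating function [Sahi2008, Prop. 12])
`E_n(D) = a(a+1)⋯(a+n−2)·b − Σ_{k≥2} (a+k−1)⋯(a+n−2)·e_k(c) = −Σ_{J ⊆ [n]} c_J · (a+|J|−1)(a+|J|)⋯(a+n−2)`.
Here we take the RECURSIVE form of this polynomial as a definition,
  `J_0(a; ·) = −1`,  `J_{n+1}(a; c_0, c) = (a + n − 1)·J_n(a; c) + c_0·J_n(a + 1; c)`  (`rowJ`),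
and prove, by elementary inductions (no symmetric functions, no binomial identities):
* `rowJ_removeNth` — the same recursion holds at EVERY slot `p` (`J_{n+1}(a;c) = (a+n−1)J_n(a; c∖p) + c_p J_n(a+1; c∖p)`), hence
  `rowJ_update` — `J` is affine in each `c_p` with slope `J_n(a+1; c∖p)`;
* `rowJ_succ_param_sub` — `J_{n+1}(a+1; c) − J_{n+1}(a; c) = Σ_p J_n(a+1; c∖p)`;
* **`rowJ_cons_eq_sum_update`** — `J_{n+2}(a; c_0, c) = Σ_p J_{n+1}(a; c[p ↦ c_p + c_0]) − (1 − a − c_0)·J_{n+1}(a; c)`: this is EXACTLY the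
  Lieb–Sahi recursion of `E_{n+2}` on the complements of a sunflower (peeling `D_0`: `D_p ∩ D_0` merges petal `0` into petal `p`; `E(χ_{D_0}) = 1 − a − c_0`),
  so `E_n(D) = J_n(a; c)` follows slot by slot (file `…SahiSunflowerRowClosedForm`);
* `rowJ_nonpos` (`a ≥ 1`, `c ≥ 0` ⇒ `J ≤ 0`) and the two MONOTONICITIES that drive the all-`m` hierarchy theorem:
  **`rowJ_le_update_zero`** (moving a petal's mass to the outside does not decrease `J`) and **`rowJ_le_merge`** (merging petal `j` into petal
  `x` does not decrease `J`: the difference is `−c_x c_j·J_n(a+2; c∖{x,j}) ≥ 0`).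
-/

namespace Summit.CriticalPhenomena.PercolationContinuityZ3.Theorems.SahiDeltaSystem

open Finset Function

namespace Sun

/-- **The row polynomial of the sunflower tower**, recursive form: `J_0(a; ·) = −1`,
`J_{n+1}(a; c) = (a + n − 1)·J_n(a; tail c) + c_0·J_n(a + 1; tail c)`.  (`= −Σ_{J⊆[n]} c_J (a+|J|−1)⋯(a+n−2)`;
`J_1 = 1 − a − c_0 = b`, `J_2 = ab − c_0c_1`, `J_3 = (1+a)(ab − e₂) − e₃`, ….) [this work] -/
noncomputable def rowJ : (n : ℕ) → ℝ → (Fin n → ℝ) → ℝ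
  | 0, _, _ => -1
  | n + 1, a, c => (a + n - 1) * rowJ n a (Fin.tail c) + c 0 * rowJ n (a + 1) (Fin.tail c)

/-- `J_0 = −1`. [this work] -/
@[simp] theorem rowJ_zero (a : ℝ) (c : Fin 0 → ℝ) : rowJ 0 a c = -1 := rfl

/-- The defining recursion. [this work] -/
theorem rowJ_succ (n : ℕ) (a : ℝ) (c : Fin (n + 1) → ℝ) :
    rowJ (n + 1) a c = (a + n - 1) * rowJ n a (Fin.tail c) + c 0 * rowJ n (a + 1) (Fin.tail c) := rfl

/-- The defining recursion, `cons` form. [this work] -/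
theorem rowJ_cons (n : ℕ) (a c₀ : ℝ) (c : Fin n → ℝ) :
    rowJ (n + 1) a (Fin.cons c₀ c) = (a + n - 1) * rowJ n a c + c₀ * rowJ n (a + 1) c := by
  rw [rowJ_succ, Fin.tail_cons, Fin.cons_zero]

/-- `J_1(a; c) = 1 − a − c_0` (the outside mass `b`). [this work] -/
theorem rowJ_one (a : ℝ) (c : Fin 1 → ℝ) : rowJ 1 a c = 1 - a - c 0 := by
  rw [rowJ_succ, rowJ_zero, rowJ_zero]; push_cast; ring

/-- `J_2(a; c) = a(1 − a − c_0 − c_1) − c_0 c_1 = ab − c_0c_1`. [this work] -/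
theorem rowJ_two (a : ℝ) (c : Fin 2 → ℝ) : rowJ 2 a c = a * (1 - a - c 0 - c 1) - c 0 * c 1 := by
  rw [rowJ_succ, rowJ_one, rowJ_one]
  simp only [Fin.tail, Nat.cast_one, Fin.succ_zero_eq_one]
  ring

/-- Removing a successor slot from a `cons` tuple. [this work] -/
theorem removeNth_succ_cons {n : ℕ} (c₀ : ℝ) (c : Fin (n + 1) → ℝ) (p : Fin (n + 1)) :
    p.succ.removeNth (Fin.cons c₀ c : Fin (n + 2) → ℝ) = (Fin.cons c₀ (p.removeNth c) : Fin (n + 1) → ℝ) := by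
  funext i
  refine Fin.cases ?_ (fun k => ?_) i
  · simp [Fin.removeNth]
  · simp [Fin.removeNth]

/-- **The recursion holds at every slot**: `J_{n+1}(a; c) = (a + n − 1)·J_n(a; c∖p) + c_p·J_n(a+1; c∖p)`. [this work] -/
theorem rowJ_removeNth : ∀ (n : ℕ) (a : ℝ) (c : Fin (n + 1) → ℝ) (p : Fin (n + 1)),
    rowJ (n + 1) a c = (a + n - 1) * rowJ n a (p.removeNth c) + c p * rowJ n (a + 1) (p.removeNth c)
  | 0, a, c, p => by
    have hp : p = 0 := Fin.eq_zero p
    subst hp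
    rw [rowJ_succ, Fin.removeNth_zero]
  | n + 1, a, c, p => by
    refine Fin.cases ?_ (fun q => ?_) p
    · rw [rowJ_succ, Fin.removeNth_zero]
    · -- write `c = cons c₀ c'` and use the recursion for `c'` at slot `q`
      have hc : c = Fin.cons (c 0) (Fin.tail c) := (Fin.cons_self_tail c).symm
      rw [hc, removeNth_succ_cons, rowJ_cons, rowJ_cons, rowJ_cons, Fin.cons_succ,
        rowJ_removeNth n a (Fin.tail c) q, rowJ_removeNth n (a + 1) (Fin.tail c) q]
      push_cast
      ring

/-- **`J` is affine in each petal mass**, with slope `J_n(a+1; c∖p)`. [this work] -/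
theorem rowJ_update {n : ℕ} (a : ℝ) (c : Fin (n + 1) → ℝ) (p : Fin (n + 1)) (v : ℝ) :
    rowJ (n + 1) a (update c p v) = rowJ (n + 1) a c + (v - c p) * rowJ n (a + 1) (p.removeNth c) := by
  rw [rowJ_removeNth n a (update c p v) p, rowJ_removeNth n a c p, Fin.removeNth_update, update_self]
  ring

/-- **Shift of the core parameter**: `J_{n+1}(a+1; c) − J_{n+1}(a; c) = Σ_p J_n(a+1; c∖p)`. [this work] -/
theorem rowJ_succ_param_sub : ∀ (n : ℕ) (a : ℝ) (c : Fin (n + 1) → ℝ),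
    rowJ (n + 1) (a + 1) c - rowJ (n + 1) a c = ∑ p : Fin (n + 1), rowJ n (a + 1) (p.removeNth c)
  | 0, a, c => by
    rw [rowJ_one, rowJ_one, Fin.sum_univ_one, rowJ_zero]
    ring
  | n + 1, a, c => by
    have hrem : ∀ q : Fin (n + 1), q.succ.removeNth c = (Fin.cons (c 0) (q.removeNth (Fin.tail c)) : Fin (n + 1) → ℝ) := by
      intro q
      conv_lhs => rw [← Fin.cons_self_tail c]
      rw [removeNth_succ_cons]
    have ih1 := rowJ_succ_param_sub n a (Fin.tail c)
    have ih2 := rowJ_succ_param_sub n (a + 1) (Fin.tail c)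
    rw [rowJ_succ (n + 1) (a + 1) c, rowJ_succ (n + 1) a c, Fin.sum_univ_succ, Fin.removeNth_zero]
    simp_rw [hrem, rowJ_cons]
    rw [Finset.sum_add_distrib, ← Finset.mul_sum, ← Finset.mul_sum, ← ih1, ← ih2]
    push_cast
    ring

/-- **The Lieb–Sahi recursion on the sunflower complements, as an identity of `J`**:
`J_{n+2}(a; c_0, c) = Σ_p J_{n+1}(a; c[p ↦ c_p + c_0]) − (1 − a − c_0)·J_{n+1}(a; c)`. [this work] -/
theorem rowJ_cons_eq_sum_update (n : ℕ) (a c₀ : ℝ) (c : Fin (n + 1) → ℝ) :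
    rowJ (n + 2) a (Fin.cons c₀ c) =
      (∑ p : Fin (n + 1), rowJ (n + 1) a (update c p (c p + c₀))) - (1 - a - c₀) * rowJ (n + 1) a c := by
  have key : ∑ p : Fin (n + 1), rowJ (n + 1) a (update c p (c p + c₀)) =
      (n + 1) * rowJ (n + 1) a c + c₀ * (rowJ (n + 1) (a + 1) c - rowJ (n + 1) a c) := by
    rw [rowJ_succ_param_sub, Finset.mul_sum]
    conv_lhs => arg 2; ext p; rw [rowJ_update, add_sub_cancel_left]
    rw [Finset.sum_add_distrib, Finset.sum_const, Finset.card_univ, Fintype.card_fin]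
    simp
  rw [key, rowJ_cons]
  push_cast
  ring

/-- **Sign**: for `a ≥ 1` and `c ≥ 0`, `J_n(a; c) ≤ 0` (every term of `−Σ_J c_J (a+|J|−1)⋯` is then nonpositive). [this work] -/
theorem rowJ_nonpos : ∀ (n : ℕ) {a : ℝ}, 1 ≤ a → ∀ {c : Fin n → ℝ}, (∀ i, 0 ≤ c i) → rowJ n a c ≤ 0
  | 0, a, _, c, _ => by rw [rowJ_zero]; norm_num
  | n + 1, a, ha, c, hc => by
    rw [rowJ_succ]
    have h1 : rowJ n a (Fin.tail c) ≤ 0 := rowJ_nonpos n ha fun i => hc _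
    have h2 : rowJ n (a + 1) (Fin.tail c) ≤ 0 := rowJ_nonpos n (by linarith) fun i => hc _
    have han : 0 ≤ a + n - 1 := by
      have : (0 : ℝ) ≤ n := Nat.cast_nonneg n
      linarith
    nlinarith [hc 0]

/-- **Monotonicity I (petal → outside)**: zeroing a petal mass (the mass goes to the outside, `a` fixed) does not decrease `J`:
`J(c[p ↦ 0]) − J(c) = −c_p·J_n(a+1; c∖p) ≥ 0`. [this work] -/
theorem rowJ_le_update_zero {n : ℕ} {a : ℝ} (ha : 0 ≤ a) {c : Fin (n + 1) → ℝ} (hc : ∀ i, 0 ≤ c i) (p : Fin (n + 1)) :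
    rowJ (n + 1) a c ≤ rowJ (n + 1) a (update c p 0) := by
  rw [rowJ_update]
  have h := rowJ_nonpos n (a := a + 1) (by linarith) (c := p.removeNth c) fun i => hc _
  nlinarith [hc p]

/-- **Monotonicity II (petal → petal)**: merging petal `j` into petal `x ≠ j` does not decrease `J`:
`J(c[x ↦ c_x + c_j][j ↦ 0]) − J(c) = −c_x c_j·J_n(a+2; c∖{x,j}) ≥ 0`. [this work] -/
theorem rowJ_le_merge {n : ℕ} {a : ℝ} (ha : 0 ≤ a) {c : Fin (n + 2) → ℝ} (hc : ∀ i, 0 ≤ c i) {x j : Fin (n + 2)}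
    (hxj : x ≠ j) : rowJ (n + 2) a c ≤ rowJ (n + 2) a (update (update c x (c x + c j)) j 0) := by
  obtain ⟨x', rfl⟩ := Fin.exists_succAbove_eq hxj
  generalize hw : update (update c (j.succAbove x') (c (j.succAbove x') + c j)) j 0 = w
  have hwj : w j = 0 := by rw [← hw, update_self]
  have hremw : j.removeNth w = update (j.removeNth c) x' (c (j.succAbove x') + c j) := by
    rw [← hw, Fin.removeNth_update, Fin.removeNth_update_succAbove]
  have e1 : rowJ (n + 2) a w = (a + ((n + 1 : ℕ) : ℝ) - 1) *
      (rowJ (n + 1) a (j.removeNth c) + c j * rowJ n (a + 1) (x'.removeNth (j.removeNth c))) := by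
    rw [rowJ_removeNth (n + 1) a w j, hwj, hremw, rowJ_update]
    simp only [Fin.removeNth_apply]
    ring
  have e2 := rowJ_removeNth (n + 1) a c j
  have e3 := rowJ_removeNth n (a + 1) (j.removeNth c) x'
  have hneg : rowJ n (a + 1 + 1) (x'.removeNth (j.removeNth c)) ≤ 0 := rowJ_nonpos n (by linarith) fun i => hc _
  rw [e1, e2, e3]
  simp only [Fin.removeNth_apply]
  push_cast
  nlinarith [mul_nonneg (mul_nonneg (hc (j.succAbove x')) (hc j)) (neg_nonneg.2 hneg)]

end Sun
end Summit.CriticalPhenomena.PercolationContinuityZ3.Theorems.SahiDeltaSystem
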